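import Literature.Geometry.Riemannian.CompactShrinkerEinsteinPotential
import Literature.Geometry.Riemannian.RiemannianCoveringVolume
import Literature.Geometry.Riemannian.RoundSphereThreeVolume
import Literature.Geometry.Riemannian.KillingHopfPositive
import Literature.Geometry.Riemannian.VolumeScaling
import Literature.Geometry.Riemannian.CompactComplete
import HarnessLib

/-!
# The spherical case of the classification of three-dimensional gradient shrinkers:
# `Vol(S³(2)/Γ) = 16π²/|Γ|` and disjunct (a) of the model data

Fifth companion of `ThreeShrinkerClassification.lean` (named fact
`Literature.Geometry.Riemannian.threeShrinkerClassification_modelData`, Munteanu–Wang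
arXiv:1606.01861, Thm. 1.2, exported as the model data of a normalised shrinker). This file PROVES
disjunct (a) of the fact for every COMPACT member of its binder of CONSTANT SECTIONAL CURVATURE —
the output of Ivey's theorem (Ivey 1993, Thm. 1: a compact three-dimensional shrinking soliton
has constant sectional curvature), which is the one input not formalised here:

* `riemannianMeasure_univ_of_constantCurvature_one` — **`Vol(N) = 2π²/|Γ|` for a compact
  connected Riemannian `3`-manifold of constant curvature `1`**: the local isometry
  `F : S³ → N` of the Killing–Hopf theorem (`SphereLocalIsometry.exists_isLocalIsometry`) is a
  surjective local diffeomorphism whose fibres are the orbits of its finite deck group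
  `Γ ≤ O(4)` acting freely (`KillingHopfPositive.lean`), hence have exactly `|Γ|` points; by the
  volume of a finite-sheeted covering
  (`RiemannianCovering.riemannianMeasure_univ_eq_mul_of_card_fibre`)
  and `Vol(S³) = 2π²` (`riemannianMeasure_roundMetric_sphere_three_univ`),
  `2π² = |Γ| · Vol(N)`;
* `riemannianMeasure_univ_of_constantCurvature_quarter` — for constant curvature `¼` (radius
  `2`), `Vol(N) = 16π²/|Γ|` by rescaling (`vol_constSmul`: `Vol_{c g} = c^{3/2} Vol_g`,
  `(¼)^{3/2} = ⅛`);
* `modelData_a_of_constantCurvature` — with `CompactShrinkerEinsteinPotential.lean`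
  (`K = ¼`, `R ≡ φ ≡ 3/2` for a compact normalised shrinker of constant curvature `K`):
  **disjunct (a)** `CompactSpace N ∧ R ≡ 3/2 ∧ φ ≡ 3/2 ∧ ∃ k ≥ 1, Vol(N) = 16π²/k`, and the
  fact's four-way disjunction in that case (`modelData_of_constantCurvature`).

Everything is proved; no definitions, no named facts (D-0026). What is NOT here: Ivey's theorem.

## References

* O. Munteanu, J. Wang, *Structure at infinity for shrinking Ricci solitons*, arXiv:1606.01861,
  Thm. 1.2 (p. 3); proof of Thm. 5.1 (p. 21). [MunteanuWang2016]
* T. Ivey, *Ricci solitons on compact three-manifolds*, Diff. Geom. Appl. 3 (1993), Thm. 1.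
  [Ivey1993]
* H.-D. Cao, B.-L. Chen, X.-P. Zhu, Surveys in Differential Geometry XII (2008), Lemma 4.6 (p. 77).
  [CaoChenZhu2007]
* J. M. Lee, *Introduction to Riemannian Manifolds*, 2nd ed. (2018), Thm. 12.4, Cor. 12.5,
  Problem 2-14. [Lee2018]
* I. Chavel, *Riemannian Geometry: A Modern Introduction*, 2nd ed. (2006), Exercise IV.18
  (`V(M) = V(M_o) · card Γ` for a Riemannian covering). [Chavel2006]
-/

noncomputable section

open Bundle Set Function Filter Module MeasureTheory Metric
open scoped Manifold ContDiff Topology ENNReal NNReal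

namespace Literature.Geometry.Riemannian

open Lorentzian Lorentzian.PseudoRiemannianMetric

namespace ThreeShrinker

variable (N : Type*) [TopologicalSpace N] [T2Space N]
  [ChartedSpace (EuclideanSpace ℝ (Fin 3)) N] [IsManifold (𝓡 3) ∞ N] [CompactSpace N]
  [ConnectedSpace N] [MeasurableSpace N] [BorelSpace N]
  (g : PseudoRiemannianMetric (𝓡 3) ∞ (EuclideanSpace ℝ (Fin 3))
    (TangentSpace (𝓡 3) : N → Type _)) [g.HasLeviCivita] (hg : g.IsRiemannian)

/-- **`Vol(N) · |Γ|⁻¹`-formula for compact space forms of curvature `1`: `|Γ| · Vol(N) = 2π²`.**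
For a compact connected Riemannian `3`-manifold `(N, g)` of constant sectional curvature `1` for
its Levi-Civita connection there is an integer `k ≥ 1` (the order of the deck group of the
Killing–Hopf local isometry `S³ → N`) with `Vol_g(N) = 2π²/k`, here as `k · Vol_g(N) = 2π²`
in `ℝ≥0∞`. [cite: Lee2018, Thm. 12.4, Cor. 12.5 and Problem 2-14]
[cite: Chavel2006, Exercise IV.18] -/
theorem riemannianMeasure_univ_of_constantCurvature_one
    (hK : g.HasConstantSectionalCurvatureWith g.leviCivita 1) :
    ∃ k : ℕ, 0 < k ∧ (k : ℝ≥0∞) * riemannianMeasure (g.toContMDiffRiemannianMetric hg) univ =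
      ENNReal.ofReal (2 * Real.pi ^ 2) := by
  haveI : LocallyCompactSpace N := inferInstance
  haveI : Fact (finrank ℝ (EuclideanSpace ℝ (Fin 4)) = 3 + 1) := ⟨finrank_euclideanSpace_fin⟩
  haveI := (roundMetric (n := 3) (EuclideanSpace ℝ (Fin 4))).hasLeviCivita
  have h2 : (2 : ℕ∞ω) ≤ ((⊤ : ℕ∞) : ℕ∞ω) := WithTop.coe_le_coe.2 le_top
  have hc : IsGeodesicallyComplete g.leviCivita := g.isGeodesicallyComplete_of_compactSpace h2 hg
  have hdim : finrank ℝ (EuclideanSpace ℝ (Fin 3)) = 3 := finrank_euclideanSpace_fin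
  obtain ⟨pt⟩ : Nonempty N := inferInstance
  have p : sphere (0 : EuclideanSpace ℝ (Fin 4)) 1 := ⟨EuclideanSpace.single 0 1, by simp⟩
  obtain ⟨F, -, hF, hiso⟩ :=
    SphereLocalIsometry.exists_isLocalIsometry (V := EuclideanSpace ℝ (Fin 4)) (n := 3)
      (by norm_num) hg hK hc hdim p pt
  have hloc := KillingHopf.isLocalDiffeomorph_of_isometric hdim hF hiso
  have hsurj := KillingHopf.surjective_of_isLocalDiffeomorph hloc
  have hfree : ∀ A ∈ KillingHopf.deckGroup (EuclideanSpace ℝ (Fin 4)) F,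
      ∀ x : sphere (0 : EuclideanSpace ℝ (Fin 4)) 1,
        A x = (x : EuclideanSpace ℝ (Fin 4)) → A = 1 :=
    fun A hA x hx ↦ KillingHopf.eq_one_of_mem_deckGroup_of_apply_eq hF hiso hA hx
  haveI : Finite (KillingHopf.deckGroup (EuclideanSpace ℝ (Fin 4)) F) :=
    KillingHopf.finite_deckGroup hloc hfree
  haveI : Fintype (KillingHopf.deckGroup (EuclideanSpace ℝ (Fin 4)) F) := Fintype.ofFinite _
  set k : ℕ := Fintype.card (KillingHopf.deckGroup (EuclideanSpace ℝ (Fin 4)) F) with hk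
  -- every fibre is an orbit of the deck group, with exactly `k` points
  have hfib : ∀ y : N, ∃ s : Finset (sphere (0 : EuclideanSpace ℝ (Fin 4)) 1), s.card = k ∧
      ∀ x, x ∈ s ↔ F x = y := by
    classical
    intro y
    obtain ⟨x₀, rfl⟩ := hsurj y
    refine ⟨Finset.univ.image fun A : KillingHopf.deckGroup (EuclideanSpace ℝ (Fin 4)) F ↦
      sphereMap A.1 x₀, ?_, fun x ↦ ?_⟩
    · rw [Finset.card_image_of_injective _ ?_, Finset.card_univ]
      intro A B hAB
      have h' : sphereMap A.1 x₀ = sphereMap B.1 x₀ := hAB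
      have hfix : (B.1⁻¹ * A.1) x₀ = (x₀ : EuclideanSpace ℝ (Fin 4)) := by
        have h'' : A.1 (x₀ : EuclideanSpace ℝ (Fin 4)) = B.1 (x₀ : EuclideanSpace ℝ (Fin 4)) :=
          congrArg Subtype.val h'
        show B.1⁻¹ (A.1 (x₀ : EuclideanSpace ℝ (Fin 4))) = x₀
        rw [h'']
        exact B.1.symm_apply_apply (x₀ : EuclideanSpace ℝ (Fin 4))
      have h1 := hfree _ (mul_mem (inv_mem B.2) A.2) x₀ hfix
      exact Subtype.ext (inv_mul_eq_one.1 h1).symm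
    · simp only [Finset.mem_image, Finset.mem_univ, true_and]
      constructor
      · rintro ⟨A, rfl⟩
        exact A.2 x₀
      · intro hxy
        obtain ⟨A, hA, hAx⟩ :=
          KillingHopf.exists_mem_deckGroup_apply_eq (by norm_num) hdim hF hiso hxy.symm
        exact ⟨⟨A, hA⟩, Subtype.ext hAx⟩
  have hkpos : 0 < k := Fintype.card_pos
  refine ⟨k, hkpos, ?_⟩
  have hcount := RiemannianCovering.riemannianMeasure_univ_eq_mul_of_card_fibre
    isRiemannian_roundMetric hg hF hloc hiso rfl hsurj hfib
  rw [← hcount, riemannianMeasure_roundMetric_sphere_three_univ]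

omit [g.HasLeviCivita] in
/-- **Compact space forms of curvature `¼`: `Vol(N) = 16π²/k`** (`Vol(S³(2)) = 2³ · 2π² = 16π²`;
rescaling `g ↦ ¼ g` gives curvature `1` and divides volume by `8`, `vol_constSmul`).
[cite: MunteanuWang2016, proof of Thm 5.1 (p. 21)] [cite: Lee2018, Thm. 12.4 and Cor. 12.5] -/
theorem riemannianMeasure_univ_of_constantCurvature_quarter [T3Space N]
    (hK : g.HasConstantSectionalCurvature (1 / 4)) :
    ∃ k : ℕ, 0 < k ∧ riemannianMeasure (g.toContMDiffRiemannianMetric hg) univ =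
      ENNReal.ofReal (16 * Real.pi ^ 2 / k) := by
  have hq : (0 : ℝ) < 1 / 4 := by norm_num
  set g' := g.constSmul (1 / 4) hq.ne' with hg'def
  haveI := g'.hasLeviCivita
  have hg' : g'.IsRiemannian := hg.constSmul hq
  -- `g'.leviCivita` is a Levi-Civita connection of `g`, so `(g', ∇')` has constant curvature `1`
  have hLC' : g'.IsLeviCivita g'.leviCivita := isLeviCivita_leviCivita_holds (g := g')
  have hLC : g.IsLeviCivita g'.leviCivita := (isLeviCivita_constSmul_iff hq.ne').1 hLC'
  have hKc : g.HasConstantSectionalCurvatureWith g'.leviCivita (1 / 4) := hK _ hLC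
  have hK1 : g'.HasConstantSectionalCurvatureWith g'.leviCivita 1 := by
    intro x X Y Z W
    show (g.constSmul (1 / 4) hq.ne').curvatureForm g'.leviCivita x X Y Z W =
      1 * ((g.constSmul (1 / 4) hq.ne').val x Y Z * (g.constSmul (1 / 4) hq.ne').val x X W -
        (g.constSmul (1 / 4) hq.ne').val x X Z * (g.constSmul (1 / 4) hq.ne').val x Y W)
    rw [curvatureForm_constSmul, hKc.curvatureForm_eq]
    simp only [constSmul_apply]
    ring
  obtain ⟨k, hk, hvol'⟩ := riemannianMeasure_univ_of_constantCurvature_one N g' hg' hK1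
  refine ⟨k, hk, ?_⟩
  -- `Vol_{g'} = (1/2)³ Vol_g`
  have hscale : riemannianMeasure (g'.toContMDiffRiemannianMetric hg') univ =
      ENNReal.ofReal (Real.sqrt (1 / 4)) ^ 3 * riemannianMeasure (g.toContMDiffRiemannianMetric hg)
        univ := by
    have h := vol_constSmul g hq (univ : Set N)
    rw [PseudoRiemannianMetric.vol, PseudoRiemannianMetric.vol, riemVolume_eq hg', riemVolume_eq hg,
      finrank_euclideanSpace_fin] at h
    exact h
  have hsqrt : Real.sqrt (1 / 4) = 1 / 2 := by
    rw [show (1 / 4 : ℝ) = (1 / 2) ^ 2 by norm_num, Real.sqrt_sq (by norm_num)]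
  rw [hscale, hsqrt] at hvol'
  set Y := riemannianMeasure (g.toContMDiffRiemannianMetric hg) univ with hY
  -- solve `k · (1/2)³ · Y = 2π²` for `Y`
  have hcoef : (k : ℝ≥0∞) * ENNReal.ofReal (1 / 2) ^ 3 = ENNReal.ofReal (k / 8) := by
    rw [← ENNReal.ofReal_pow (by norm_num), ← ENNReal.ofReal_natCast, ← ENNReal.ofReal_mul
      (Nat.cast_nonneg _)]
    congr 1
    norm_num
    ring
  rw [← mul_assoc, hcoef] at hvol'
  have hk8 : (0 : ℝ) < k / 8 := by positivity
  have hYtop : Y ≠ ⊤ := by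
    intro htop
    rw [htop, ENNReal.mul_top (by simpa using hk8)] at hvol'
    exact ENNReal.ofReal_ne_top hvol'.symm
  have hreal := congrArg ENNReal.toReal hvol'
  rw [ENNReal.toReal_mul, ENNReal.toReal_ofReal hk8.le, ENNReal.toReal_ofReal (by positivity)]
    at hreal
  have hYr : Y.toReal = 16 * Real.pi ^ 2 / k := by
    have hk0 : (k : ℝ) ≠ 0 := by exact_mod_cast hk.ne'
    field_simp at hreal ⊢
    linarith
  rw [← ENNReal.ofReal_toReal hYtop, hYr]

/-- **Disjunct (a) of `threeShrinkerClassification_modelData` from constant curvature.** In the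
fact's binder with `N` compact and `h` of constant sectional curvature `K` (Ivey 1993, Thm. 1):
`K = ¼` and `R ≡ φ ≡ 3/2` (`constantCurvatureShrinker_three_of_compactSpace'`), and
`Vol(N) = 16π²/k` for the order `k ≥ 1` of the deck group of `S³ → N`
(`riemannianMeasure_univ_of_constantCurvature_quarter`) — derivation (a) of the fact's docstring.
[cite: MunteanuWang2016, Thm 1.2 (p. 3); proof of Thm 5.1 (p. 21)] [cite: Ivey1993, Thm 1]
[cite: CaoChenZhu2007, Lemma 4.6 (p. 77)] -/
theorem modelData_a_of_constantCurvature [T3Space N] (φ : N → ℝ)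
    (hφ : ContMDiff (𝓡 3) 𝓘(ℝ, ℝ) ∞ φ)
    (hsol : ∀ (x : N) (X Y : TangentSpace (𝓡 3) x),
      g.ricci x X Y + g.hessian φ x X Y = (1 / 2 : ℝ) * g.val x X Y)
    (hnorm : ∀ x : N, g.scalarCurvature x + g.gradSq φ x = φ x)
    {K : ℝ} (hK : g.HasConstantSectionalCurvature K) :
    CompactSpace N ∧ (∀ x : N, g.scalarCurvature x = 3 / 2) ∧ (∀ x : N, φ x = 3 / 2) ∧
      ∃ k : ℕ, 0 < k ∧
        riemannianMeasure (g.toContMDiffRiemannianMetric hg) Set.univ =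
          ENNReal.ofReal (16 * Real.pi ^ 2 / k) := by
  obtain ⟨hKq, hR, hf⟩ := constantCurvatureShrinker_three_of_compactSpace' N g φ hg hφ hsol hnorm hK
  subst hKq
  exact ⟨inferInstance, hR, hf, riemannianMeasure_univ_of_constantCurvature_quarter N g hg hK⟩

/-- **The conclusion of `threeShrinkerClassification_modelData` for compact members of its
binder of constant sectional curvature** (its four-way disjunction, by the second disjunct).
What remains for the compact half of the fact is Ivey's theorem (compact three-dimensional
shrinkers have constant sectional curvature). [cite: MunteanuWang2016, Thm 1.2 (p. 3)]
[cite: Ivey1993, Thm 1] -/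
theorem modelData_of_constantCurvature [T3Space N] (φ : N → ℝ)
    (hφ : ContMDiff (𝓡 3) 𝓘(ℝ, ℝ) ∞ φ)
    (hsol : ∀ (x : N) (X Y : TangentSpace (𝓡 3) x),
      g.ricci x X Y + g.hessian φ x X Y = (1 / 2 : ℝ) * g.val x X Y)
    (hnorm : ∀ x : N, g.scalarCurvature x + g.gradSq φ x = φ x)
    {K : ℝ} (hK : g.HasConstantSectionalCurvature K) :
    ((∀ x : N, g.scalarCurvature x = 0) ∧
        ∫⁻ x, ENNReal.ofReal (Real.exp (-φ x))
            ∂(riemannianMeasure (g.toContMDiffRiemannianMetric hg)) =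
          ENNReal.ofReal (8 * Real.pi * Real.sqrt Real.pi)) ∨
    (CompactSpace N ∧ (∀ x : N, g.scalarCurvature x = 3 / 2) ∧ (∀ x : N, φ x = 3 / 2) ∧
        ∃ k : ℕ, 0 < k ∧
          riemannianMeasure (g.toContMDiffRiemannianMetric hg) Set.univ =
            ENNReal.ofReal (16 * Real.pi ^ 2 / k)) ∨
    ((∀ x : N, g.scalarCurvature x = 1) ∧
        ∫⁻ x, ENNReal.ofReal (Real.exp (-φ x))
            ∂(riemannianMeasure (g.toContMDiffRiemannianMetric hg)) =
          ENNReal.ofReal (16 * Real.pi * Real.sqrt Real.pi * Real.exp (-1))) ∨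
    ((∀ x : N, g.scalarCurvature x = 1) ∧
        ∫⁻ x, ENNReal.ofReal (Real.exp (-φ x))
            ∂(riemannianMeasure (g.toContMDiffRiemannianMetric hg)) =
          ENNReal.ofReal (8 * Real.pi * Real.sqrt Real.pi * Real.exp (-1))) :=
  Or.inr (Or.inl (modelData_a_of_constantCurvature N g hg φ hφ hsol hnorm hK))

end ThreeShrinker

end Literature.Geometry.Riemannian

end
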